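import Literature.AlgebraicGeometry.Motives.CurveDivisorsFunctionField
import Literature.AlgebraicGeometry.Motives.PureCodimOneDivisor
import HarnessLib

/-!
# The prime divisor `[x]` of a closed point of a smooth curve (Hartshorne II.6)

For a smooth curve `C / K` (integral, smooth of relative dimension one) and a closed (= non-generic)
point `x`, this file constructs the **prime divisor `[x]`** as an effective Cartier divisor
(`pointDivisor C hx : CartierDivisor C.left`) — Hartshorne II.6: on a nonsingular curve the Weil
divisors, the free abelian group on the closed points, are the Cartier divisors (Prop. 6.11 with
Prop. 6.2) — through the tree's `ComplementDivisor.divisorOfPure` (`Motives/PureCodimOneDivisor`,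
Görtz–Wedhorn II Lemma 25.150: a closed subset of pure codimension one of a locally factorial scheme
is the support of a reduced effective Cartier divisor), whose hypotheses are checked here:

* `isClosed_singleton`, `eq_of_specializes` — non-generic points are closed (`coheight ≤ 1`);
* `uniqueFactorizationMonoid_stalk` — the local rings (discrete valuation rings, or the function
  field) are factorial;
* `height_eq_one_of_mem_minimalPrimes` — purity: the prime of `x` on an affine chart has height one
  (Mathlib `idealHeight_eq_coheight`, `coheight_eq_of_isOpenImmersion`, and
  `coheight_eq_one_of_isDiscreteValuationRing` of `Motives/CurveDivisorsFunctionField`);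

and computes it: `avoids_pointDivisor_iff` (support `{x}`), **`ordAt_pointDivisor : ord_y [x] = δ_{xy}`**
(reducedness: the local equation generates a radical ideal of the DVR `𝒪_{C,x}`, hence is a
uniformizer — `ComplementDivisor.Chart.radicalAt` and the `ord`-calculus of Mathlib's `Scheme.ord`),
**`toDivisor_pointDivisor : toDivisor [x] = place x`** and **`degree_pointDivisor : deg [x] = [κ(x) : K]`**
(for `C` proper). Everything is proved; no named facts (D-0026). These are the divisors `P`, `r P`,
`D_γ = Σ Pᵢ` of Milne, *Jacobian Varieties*, §§4–6.

Mathlib searched (pin): `Order.coheight_add_one_le`, `Order.coheight_eq_zero`,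
`Specializes.antisymm`, `specializes_iff_mem_closure`, `idealHeight_eq_coheight`,
`coheight_eq_of_isOpenImmersion`, `IsAffineOpen.fromSpec_primeIdealOf`, `IsAffineOpen.isoSpec`,
`IsDiscreteValuationRing.addVal_uniformizer`, `Scheme.ord_mul` (all used); Mathlib has no divisors of
points on curves.

## References

* R. Hartshorne, *Algebraic Geometry*, GTM 52 (1977): II.6, Prop. 6.2, Cor. 6.6, Prop. 6.11.
  [Hartshorne1977]
* U. Görtz, T. Wedhorn, *Algebraic Geometry II* (2023), Lemma 25.150. [GortzWedhorn2023]
-/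

noncomputable section

open CategoryTheory AlgebraicGeometry IsLocalRing Order TopologicalSpace

universe u

namespace Literature.AlgebraicGeometry.Motives

namespace CurvePlaces

open RatFn Literature.NumberTheory.DiophantineGeometry
  Literature.NumberTheory.DiophantineGeometry.AlgFunctionField

variable {K : Type u} [Field K]

variable (C : SchemeOver K) [IsIntegral C.left] [SmoothOfRelativeDimension 1 C.hom]

omit [IsIntegral C.left] in
/-- A `K`-scheme smooth of relative dimension one is smooth over `K` (Mathlib
`SmoothOfRelativeDimension.smooth`, which is not an instance because the dimension cannot be read
off the goal; registered here for the structure morphisms `C.hom` of `K`-schemes `C : SchemeOver K`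
in relative dimension one, so that such curves are locally of finite type and locally noetherian —
the tree's `isLocallyNoetherian_left` — by instance resolution). [folklore] -/
instance smooth_hom_of_smoothCurve : Smooth C.hom := SmoothOfRelativeDimension.smooth 1 C.hom

/-! ### Closed points of a smooth curve -/

/-- Every point of a smooth curve has codimension `≤ 1`. [folklore] -/
theorem coheight_le_one (y : C.left) : coheight y ≤ 1 := by
  by_cases hy : y = genericPoint C.left
  · subst hy
    have : IsMax (genericPoint ↥C.left) := fun z hz ↦
      Scheme.le_iff_specializes.mpr (genericPoint_specializes z)
    rw [coheight_eq_zero.mpr this]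
    exact bot_le
  · haveI := isDiscreteValuationRing_stalk C hy
    exact (coheight_eq_one_of_isDiscreteValuationRing (x := y)).le

/-- A non-generic point of a smooth curve only specialises to itself (it is a closed point). [folklore] -/
theorem eq_of_specializes {x y : C.left} (hx : x ≠ genericPoint C.left) (h : x ⤳ y) : y = x := by
  by_contra hne
  haveI := isDiscreteValuationRing_stalk C hx
  have hlt : y < x := ⟨Scheme.le_iff_specializes.mpr h,
    fun h' ↦ hne (h.antisymm (Scheme.le_iff_specializes.mp h')).eq.symm⟩
  have h1 := coheight_add_one_le hlt
  rw [coheight_eq_one_of_isDiscreteValuationRing (x := x)] at h1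
  have h2 := coheight_le_one C y
  have h3 : (1 : ℕ∞) + 1 ≤ 1 := h1.trans h2
  exact absurd h3 (by decide)

/-- A non-generic point of a smooth curve is closed. [folklore] -/
theorem isClosed_singleton {x : C.left} (hx : x ≠ genericPoint C.left) :
    IsClosed ({x} : Set C.left) := by
  rw [← closure_subset_iff_isClosed]
  intro y hy
  exact eq_of_specializes C hx (specializes_iff_mem_closure.mpr hy)

/-- The open complement `C ∖ {x}` of a closed point. [folklore] -/
def complSingleton {x : C.left} (hx : x ≠ genericPoint C.left) : C.left.Opens :=
  ⟨{x}ᶜ, (isClosed_singleton C hx).isOpen_compl⟩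

/-- Membership in `C ∖ {x}`. [folklore] -/
@[simp]
theorem mem_complSingleton_iff {x : C.left} (hx : x ≠ genericPoint C.left) (y : C.left) :
    y ∈ complSingleton C hx ↔ y ≠ x := Iff.rfl

/-- `C ∖ {x}` contains the generic point. [folklore] -/
instance nonempty_complSingleton {x : C.left} (hx : x ≠ genericPoint C.left) :
    Nonempty (complSingleton C hx) := ⟨⟨genericPoint C.left, fun h ↦ hx h.symm⟩⟩

/-- The local rings of a smooth curve are factorial (discrete valuation rings, or the function
field at the generic point). [folklore] -/
theorem uniqueFactorizationMonoid_stalk (y : C.left) :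
    UniqueFactorizationMonoid (C.left.presheaf.stalk y) := by
  by_cases hy : y = genericPoint C.left
  · subst hy
    have hF : IsField (C.left.presheaf.stalk (genericPoint ↥C.left)) := by
      rw [IsLocalRing.isField_iff_maximalIdeal_eq]
      exact maximalIdeal_eq_bot_genericPoint (X := C.left)
    letI := hF.toField
    infer_instance
  · haveI := isDiscreteValuationRing_stalk C hy
    infer_instance

/-- **Purity**: on an affine chart `V`, the minimal primes of the radical ideal of `{x}` have height
one (they are the prime of the closed point `x`, whose local ring is a discrete valuation ring). [folklore] -/
theorem height_eq_one_of_mem_minimalPrimes {x : C.left} (hx : x ≠ genericPoint C.left)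
    (V : C.left.Opens) (hV : IsAffineOpen V) [Nonempty V] (P : Ideal Γ(C.left, V))
    (hP : P ∈ ((Scheme.IdealSheafData.vanishingIdeal (complSingleton C hx).compl).ideal
      ⟨V, hV⟩).minimalPrimes) : P.height = 1 := by
  classical
  haveI : P.IsPrime := hP.1.1
  -- the point `z` of `P`
  obtain ⟨zV, hzV⟩ : ∃ zV : V, hV.primeIdealOf zV = ⟨P, inferInstance⟩ := by
    obtain ⟨zV, hz⟩ := hV.isoSpec.hom.homeomorph.surjective ⟨P, inferInstance⟩
    exact ⟨zV, hz⟩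
  -- `z ∈ {x}`
  have hzx : (zV : C.left) = x := by
    have h := (vanishingIdeal_ideal_le_primeIdealOf_iff hV (complSingleton C hx).compl zV).1
      (by rw [hzV]; exact hP.1.2)
    simpa [Opens.compl, complSingleton] using h
  -- height of `P` = codimension of `x` = 1 (heights in `Spec Γ(V)` for the scheme preorder)
  haveI := isDiscreteValuationRing_stalk C hx
  have h1 := idealHeight_eq_coheight Γ(C.left, V) (hV.primeIdealOf zV)
  have h2 := coheight_eq_of_isOpenImmersion (x := hV.primeIdealOf zV) hV.fromSpec
  rw [hV.fromSpec_primeIdealOf] at h2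
  rw [hzV] at h1 h2
  change P.height = _ at h1
  rw [h1, ← h2]
  change coheight (zV : C.left) = 1
  rw [hzx]
  exact coheight_eq_one_of_isDiscreteValuationRing (x := x)

/-- **The prime divisor `[x]` of a closed point `x` of the smooth curve `C`**: the reduced effective
Cartier divisor with support `{x}` (Hartshorne II.6: on a nonsingular curve Weil divisors — the free
group on the closed points — are Cartier, Prop. 6.11; here through the tree's
`ComplementDivisor.divisorOfPure`, Görtz–Wedhorn II Lemma 25.150, the local rings being factorial).
[cite: Hartshorne1977, II.6 Prop. 6.11 and Prop. 6.2] -/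
def pointDivisor {x : C.left} (hx : x ≠ genericPoint C.left) : CartierDivisor C.left :=
  ComplementDivisor.divisorOfPure (uniqueFactorizationMonoid_stalk C) (U := complSingleton C hx)
    (height_eq_one_of_mem_minimalPrimes C hx)

/-- `[x]` is effective. [folklore] -/
theorem isEffective_pointDivisor {x : C.left} (hx : x ≠ genericPoint C.left) :
    (pointDivisor C hx).IsEffective :=
  ComplementDivisor.isEffective_divisorOfPure _ _

/-- The support of `[x]` is `{x}`. [folklore] -/
theorem avoids_pointDivisor_iff {x : C.left} (hx : x ≠ genericPoint C.left) (y : C.left) :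
    (pointDivisor C hx).Avoids y ↔ y ≠ x :=
  ComplementDivisor.avoids_divisorOfPure_iff _ _ y

variable {C}

/-- `ord_y [x] = 0` for `y ≠ x`. [folklore] -/
theorem ordAt_pointDivisor_of_ne {x : C.left} (hx : x ≠ genericPoint C.left) {y : C.left}
    (hy : y ≠ x) : (pointDivisor C hx).ordAt y = 0 := by
  haveI : Smooth C.hom := SmoothOfRelativeDimension.smooth 1 C.hom
  obtain ⟨i, hi⟩ := (pointDivisor C hx).covers y
  rw [(pointDivisor C hx).ordAt_eq_ord hi]
  exact ((avoids_pointDivisor_iff C hx y).2 hy i hi).ord_eq_zero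

/-- `ord_x(f ^ n) = n · ord_x(f)` (additivity of Mathlib's `Scheme.ord`). [folklore] -/
theorem _root_.AlgebraicGeometry.Scheme.ord_pow' {X : Scheme.{u}} [IsIntegral X] [IsLocallyNoetherian X]
    {x : X} {f : X.functionField} (hf : f ≠ 0) (n : ℕ) :
    Scheme.ord (f ^ n) x = n * Scheme.ord f x := by
  induction n with
  | zero =>
    have h1 := Scheme.ord_mul (x := x) (one_ne_zero (α := X.functionField)) one_ne_zero
    rw [mul_one] at h1
    simp only [pow_zero, Nat.cast_zero, zero_mul]
    omega
  | succ n ih =>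
    rw [pow_succ, Scheme.ord_mul (pow_ne_zero n hf) hf, ih]
    push_cast
    ring

/-- A uniformizer: a rational function of order one at the closed point `x`. [folklore] -/
theorem exists_ord_eq_one {x : C.left} (hx : x ≠ genericPoint C.left) :
    ∃ π : C.left.functionField, π ≠ 0 ∧ Scheme.ord π x = 1 := by
  haveI : Smooth C.hom := SmoothOfRelativeDimension.smooth 1 C.hom
  haveI := isDiscreteValuationRing_stalk C hx
  obtain ⟨ϖ, hϖ⟩ := IsDiscreteValuationRing.exists_irreducible (C.left.presheaf.stalk x)
  refine ⟨toFunctionField x ϖ, (map_ne_zero_iff _ (toFunctionField_injective x)).2 hϖ.ne_zero, ?_⟩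
  rw [ord_toFunctionField_eq_addVal hϖ.ne_zero, IsDiscreteValuationRing.addVal_uniformizer hϖ]
  rfl

/-- **`ord_x [x] = 1`**: the divisor `[x]` is reduced — its local equation at `x` generates a radical
ideal of the discrete valuation ring `𝒪_{C,x}`, i.e. is a uniformizer. [cite: Hartshorne1977, II.6 (valuation v_P of a prime divisor)] -/
theorem ordAt_pointDivisor_self {x : C.left} (hx : x ≠ genericPoint C.left) :
    (pointDivisor C hx).ordAt x = 1 := by
  haveI : Smooth C.hom := SmoothOfRelativeDimension.smooth 1 C.hom
  haveI := isDiscreteValuationRing_stalk C hx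
  obtain ⟨c, hc⟩ := (pointDivisor C hx).covers x
  rw [(pointDivisor C hx).ordAt_eq_ord hc]
  change Scheme.ord c.fn x = 1
  -- `g = c.fn` is regular, not a unit, and radical at `x`
  have hreg : IsRegularAt x c.fn := isEffective_pointDivisor C hx c x hc
  have hnu : ¬ IsUnitAt x c.fn := fun h ↦ ((c.isUnitAt_iff hc).1 h) rfl
  have hrad : ComplementDivisor.RadicalAt x c.fn := c.radicalAt hc
  have hg0 : c.fn ≠ 0 := c.ne_zero
  have hpos : 0 < Scheme.ord c.fn x :=
    hreg.ord_pos hnu hg0 coheight_eq_one_of_isDiscreteValuationRing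
  -- a uniformizer `π`; `π^m / g` is regular for `m = ord g`, hence `π / g` is, so `ord g ≤ 1`
  obtain ⟨π, hπ0, hπ⟩ := exists_ord_eq_one hx
  obtain ⟨m, hm⟩ : ∃ m : ℕ, Scheme.ord c.fn x = m := ⟨(Scheme.ord c.fn x).toNat, (Int.toNat_of_nonneg hpos.le).symm⟩
  have hπreg : IsRegularAt x π := (isRegularAt_iff_ord_nonneg hπ0).2 (by omega)
  have h1 : IsRegularAt x (π ^ m / c.fn) := by
    rw [isRegularAt_iff_ord_nonneg (div_ne_zero (pow_ne_zero _ hπ0) hg0)]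
    have e := Scheme.ord_mul (x := x) (div_ne_zero (pow_ne_zero m hπ0) hg0) hg0
    rw [div_mul_cancel₀ _ hg0, Scheme.ord_pow' hπ0, hπ] at e
    omega
  have h2 := hrad π m hπreg h1
  rw [isRegularAt_iff_ord_nonneg (div_ne_zero hπ0 hg0)] at h2
  have e := Scheme.ord_mul (x := x) (div_ne_zero hπ0 hg0) hg0
  rw [div_mul_cancel₀ _ hg0, hπ] at e
  omega

open Classical in
/-- **`ord_y [x] = δ_{xy}`**. [folklore] -/
theorem ordAt_pointDivisor {x : C.left} (hx : x ≠ genericPoint C.left) (y : C.left) :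
    (pointDivisor C hx).ordAt y = if y = x then 1 else 0 := by
  split_ifs with h
  · subst h; exact ordAt_pointDivisor_self hx
  · exact ordAt_pointDivisor_of_ne hx h

/-- **`toDivisor [x] = 1 · (place x)`**: the prime divisor of the closed point `x` corresponds to the
place of `x` in `Div(K(C)/K)`. [cite: Hartshorne1977, II.6 Cor. 6.6 and Prop. 6.11] -/
theorem toDivisor_pointDivisor [IsProper C.hom] {x : C.left} (hx : x ≠ genericPoint C.left) :
    toDivisor C (pointDivisor C hx) = Finsupp.single (place C x hx) 1 := by
  classical
  ext v
  rw [toDivisor_apply, ordAt_pointDivisor, Finsupp.single_apply]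
  by_cases h : pointOfPlace (C := C) v = x
  · have hv : place C x hx = v := by
      have := place_pointOfPlace (C := C) v
      simp only [h] at this
      exact this
    simp [h, hv]
  · have hv : place C x hx ≠ v := by
      rintro rfl
      exact h (pointOfPlace_place hx)
    simp [h, hv]

/-- **`deg [x] = [κ(x) : K]`**. [cite: Hartshorne1977, II.6 (degree of a divisor on a curve over k)] -/
theorem degree_pointDivisor [IsProper C.hom] {x : C.left} (hx : x ≠ genericPoint C.left) :
    CartierDivisor.degree C (pointDivisor C hx) = C.hom.residueDegree x := by
  rw [← degree_toDivisor, toDivisor_pointDivisor, Divisor.degree_single, degree_place C hx]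
  simp

end CurvePlaces

end Literature.AlgebraicGeometry.Motives
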